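import Mathlib
import Summits.NavierStokesRegularity.NavierStokesRegularity.Theorems.WakeRatchetTailRatchet.Negative.TailRatchetFalseOfDyadicScalarFronts
import HarnessLib

/-!
# `WakeRatchet.TailRatchet` (stmt-NavierStokesRegularity-21808): the blocking construction
# `DyadicScalarFronts` reduced to a ONE-PERIOD RELATIVE PERIODIC ORBIT of the local dyadic lattice

Support file for the crux `TailRatchet` (route `WakeRatchet`; MODEL lattice ODEs of Tao 2016 §4 —
nothing here is a statement about the Navier–Stokes equations).  The crux (rev 0) is refuted modulo the
construction item `DyadicScalarFronts` (`Theorems/WakeRatchetTailRatchet/Negative/…`, p589335): a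
non-trivial real function `a` on `t < 0`, integrable on `(-∞,0)` and bounded near `0⁻`, solving the
ADVANCED–RETARDED scalar front equation `a'(t) = (Λ/s²) a(t/s)² − (s/Λ) a(t) a(st)` of the inviscid
dyadic chain at arbitrarily small scale ratios `Λ = (1+ε₀)^{5/2}`.  That equation is not an initial-value
problem in either time direction, which is what makes every direct attack on it (shooting, order
intervals, monotone iteration) awkward.

THIS FILE removes the non-locality.  The lattice itself, `Ż_n = Λ^{n-1} Z_{n-1}² − Λ^n Z_n Z_{n+1}`
(`n ∈ ℤ`), IS a local ODE, and a DSS front `a_n(t) = gⁿ a(sⁿ t)` (`g = s/Λ`) is exactly a solution `Z` of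
the lattice on ONE fundamental time interval `[-s, -1]` whose END state is `g` times the SHIFT of its
START state, `Z_n(-1) = g · Z_{n-1}(-s)` — a relative periodic orbit of (flow for time `s − 1`) ∘
(`g`·shift), i.e. a fixed point of a continuous map on a box of lattice states.  This is precisely the shape
in which the tree's one successful construction of an admissible self-similar eternal lattice solution
was carried out (`PerpetualPump.CircuitPump`, stmt-1834, PROVED: truncated flow → clamp/Schauder
covering → truncation limit → `stub_dssExtension`).  We prove the dyadic analogue of the unrolling step
INCLUDING the admissibility clauses of `DyadicScalarFronts`:

* `scalarFront_of_latticePeriod` — for any `Λ > 0`, `s > 1`: a one-period lattice witness `Z` on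
  `[-s,-1]` (one-sided derivatives at the ends, relative periodicity, a wake envelope `|Z_n| ≤ P gⁿ` for
  `n < 0` and a leading-edge envelope `|Z_n| ≤ B (sΛ)^{-n}` for `n ≥ 0`) unrolls, window by window
  (`a(t) = Z_n(t/sⁿ)/gⁿ` on `sⁿ ≤ -t ≤ s^{n+1}`; the junctions `t = -sⁿ` glue by the relative
  periodicity, one-sided derivatives agree there), into a solution of the front equation at EVERY
  `t < 0`, with the integrable majorant `|a(t)| ≤ 2·max(P, Bs²)/(1+t²)` on `(-∞,0)` (so `a` is
  integrable and bounded near `0⁻`) and the dictionary `a(sⁿu) = Z_n(u)/gⁿ` (`u ∈ [-s,-1]`).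
* `isDSSWave_dyadic_of_latticePeriod` — at `Λ = bigLam ε₀` such a witness is an admissible, not
  identically zero, single-profile DSS wave of `dyadicTable` with delay `log s` (tree dictionary
  `isDSSWave_dyadic_of_scalarFront`).
* `dyadicScalarFronts_of_latticePeriods` — one-period lattice witnesses at arbitrarily small `ε₀` give
  `DyadicScalarFronts`; `not_tailRatchet_of_latticePeriods` — hence refute `TailRatchet`.

WHAT REMAINS for closing stmt-21808 as refuted (not proved here, not in print): for each small `ε₀`
separately, a fixed point of (dyadic lattice flow on `[-s,-1]`) ∘ (`(s/Λ)`·shift) inside the two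
envelopes — positivity of the chain and the one-way (upward) energy flux are the natural box; no
uniformity or asymptotics in `ε₀ → 0` is required by the statement, only that arbitrarily small `ε₀` be
reached.

HONEST FRAMING: bookkeeping (a scaling-symmetry unrolling and an integrable majorant) about a MODEL
lattice ODE; no stub of the registered skeleton is closed, no summit statement is touched.
-/

noncomputable section

set_option linter.dupNamespace false

namespace Summit.NavierStokesRegularity.NavierStokesRegularity.Theorems

namespace WakeRatchetLatticePeriod

open Set Filter Topology MeasureTheory
open Literature.Analysis.FluidPDE Literature.Analysis.FluidPDE.TaoCascade
open WakeRatchetDyadicFront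

/-- The scale bookkeeping of the unrolling: on the window of shell `n` the lattice right-hand side,
transported by `a(t) = Z_n(t/sⁿ)/gⁿ` (`g = s/Λ`), is the scalar front right-hand side. [folklore] -/
theorem piece_identity {L s : ℝ} (hL : L ≠ 0) (hs : s ≠ 0) (n : ℤ) (A Z₀ Zp : ℝ) :
    (L ^ (n - 1) * A ^ 2 - L ^ n * Z₀ * Zp) * (1 / s ^ n) / (s / L) ^ n
      = L / s ^ 2 * (A / (s / L) ^ (n - 1)) ^ 2 - s / L * (Z₀ / (s / L) ^ n) * (Zp / (s / L) ^ (n + 1)) := by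
  have hg : s / L ≠ 0 := div_ne_zero hs hL
  have h1 : L ^ (n - 1) = L ^ n / L := zpow_sub_one₀ hL n
  have h2 : (s / L) ^ (n - 1) = (s / L) ^ n / (s / L) := zpow_sub_one₀ hg n
  have h3 : (s / L) ^ (n + 1) = (s / L) ^ n * (s / L) := zpow_add_one₀ hg n
  have h4 : (s / L) ^ n = s ^ n / L ^ n := div_zpow s L n
  have hLn : L ^ n ≠ 0 := zpow_ne_zero n hL
  have hsn : s ^ n ≠ 0 := zpow_ne_zero n hs
  rw [h1, h2, h3, h4]
  field_simp

/-- **Unrolling a one-period lattice witness into a scalar DSS front profile.**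
Let `Λ > 0`, `s > 1`, `g = s/Λ`, and let `Z : ℤ → ℝ → ℝ` solve the inviscid dyadic lattice
`Ż_n = Λ^{n-1} Z_{n-1}² − Λ^n Z_n Z_{n+1}` on the time interval `[-s, -1]` (one-sided derivatives at the
ends) with the RELATIVE PERIODICITY `Z_n(-1) = g · Z_{n-1}(-s)` (the end state is `g` times the shift of
the start state), a wake envelope `|Z_n| ≤ P gⁿ` for `n < 0` and a leading-edge envelope
`|Z_n| ≤ B (sΛ)^{-n}` for `n ≥ 0`.  Then the function `a` on `t < 0` defined window-wise by
`a(t) = Z_n(t/sⁿ)/gⁿ` for `sⁿ ≤ -t ≤ s^{n+1}` (so that `Z_n(u) = gⁿ a(sⁿ u)`: the DSS ansatz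
`a_n(t) = gⁿ a(sⁿ t)`) solves the scalar front equation
`a'(t) = (Λ/s²) a(t/s)² − (s/Λ) a(t) a(st)` at every `t < 0`, is integrable on `(-∞, 0)`
(`|a(t)| ≤ 2 max(P, Bs²)/(1+t²)`), bounded near `0⁻`, and extends `Z` through the dictionary.
[cite: Tao2016AveragedNS, §1.2 (the dyadic model) and §4 Lemma 4.1 (4.8) (the lattice law; scaling
covariance `X_n(t) ↦ c X_{n+1}(ct/Λ)`); folklore (unrolling a relative periodic orbit by a scaling
symmetry, as in `PerpetualPumpCircuitPump.stub_dssExtension`)] -/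
theorem scalarFront_of_latticePeriod {L s : ℝ} (hL : 0 < L) (hs : 1 < s) {Z : ℤ → ℝ → ℝ}
    (hZ : ∀ n : ℤ, ∀ u ∈ Icc (-s) (-1), HasDerivWithinAt (Z n)
      (L ^ (n - 1) * Z (n - 1) u ^ 2 - L ^ n * Z n u * Z (n + 1) u) (Icc (-s) (-1)) u)
    (hper : ∀ n : ℤ, Z n (-1) = s / L * Z (n - 1) (-s))
    (hwake : ∃ P : ℝ, ∀ n : ℤ, n < 0 → ∀ u ∈ Icc (-s) (-1), |Z n u| ≤ P * (s / L) ^ n)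
    (hlead : ∃ B : ℝ, ∀ n : ℤ, 0 ≤ n → ∀ u ∈ Icc (-s) (-1), |Z n u| ≤ B * ((s * L) ^ n)⁻¹) :
    ∃ a : ℝ → ℝ,
      (∀ t : ℝ, t < 0 → HasDerivAt a
        (L / s ^ 2 * a (t / s) ^ 2 - s / L * a t * a (s * t)) t) ∧
      IntegrableOn a (Iio 0) ∧
      (∃ t₀ : ℝ, t₀ < 0 ∧ ∃ P : ℝ, ∀ t : ℝ, t₀ ≤ t → t < 0 → |a t| ≤ P) ∧
      (∀ n : ℤ, ∀ u ∈ Icc (-s) (-1), a (s ^ n * u) = Z n u / (s / L) ^ n) := by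
  obtain ⟨P, hP⟩ := hwake
  obtain ⟨B, hB⟩ := hlead
  have hs0 : 0 < s := lt_trans zero_lt_one hs
  have hsne : s ≠ 0 := hs0.ne'
  have hLne : L ≠ 0 := hL.ne'
  set g : ℝ := s / L with hgdef
  have hg0 : 0 < g := div_pos hs0 hL
  have hgne : g ≠ 0 := hg0.ne'
  have hsn : ∀ n : ℤ, 0 < s ^ n := fun n => zpow_pos hs0 n
  have hgn : ∀ n : ℤ, 0 < g ^ n := fun n => zpow_pos hg0 n
  have hs_succ : ∀ n : ℤ, s ^ (n + 1) = s ^ n * s := fun n => zpow_add_one₀ hsne n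
  -- windows: shell `n` owns the times `t` with `sⁿ ≤ -t < s^{n+1}`, i.e. `t/sⁿ ∈ (-s, -1]`
  have hcov : ∀ t : ℝ, ∃ n : ℤ, t < 0 → -t ∈ Ico (s ^ n) (s ^ (n + 1)) := by
    intro t
    by_cases ht : t < 0
    · obtain ⟨n, hn⟩ := exists_mem_Ico_zpow (neg_pos.2 ht) hs
      exact ⟨n, fun _ => hn⟩
    · exact ⟨0, fun h => absurd h ht⟩
  choose N hN using hcov
  have huniq : ∀ t : ℝ, t < 0 → ∀ n : ℤ, -t ∈ Ico (s ^ n) (s ^ (n + 1)) → N t = n := by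
    intro t ht n hn
    obtain ⟨h1, h2⟩ := hN t ht
    by_contra hne
    rcases lt_or_gt_of_ne hne with h | h
    · have : s ^ (N t + 1) ≤ s ^ n := zpow_le_zpow_right₀ hs.le (by omega)
      linarith [hn.1]
    · have : s ^ (n + 1) ≤ s ^ N t := zpow_le_zpow_right₀ hs.le (by omega)
      linarith [hn.2]
  -- window membership in the `u = t/sⁿ` variable
  have hu_le : ∀ (n : ℤ) (t : ℝ), t / s ^ n ≤ -1 ↔ s ^ n ≤ -t := by
    intro n t
    rw [div_le_iff₀ (hsn n)]
    constructor <;> intro h <;> linarith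
  have hu_ge : ∀ (n : ℤ) (t : ℝ), -s ≤ t / s ^ n ↔ -t ≤ s ^ (n + 1) := by
    intro n t
    rw [le_div_iff₀ (hsn n), hs_succ]
    constructor <;> intro h <;> linarith
  have hu_gt : ∀ (n : ℤ) (t : ℝ), -s < t / s ^ n ↔ -t < s ^ (n + 1) := by
    intro n t
    rw [lt_div_iff₀ (hsn n), hs_succ]
    constructor <;> intro h <;> linarith
  -- the profile
  obtain ⟨a, hadef⟩ : ∃ a : ℝ → ℝ, ∀ t, a t = Z (N t) (t / s ^ N t) / g ^ N t := ⟨_, fun _ => rfl⟩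
  -- `a` is given by the shell-`n` formula on the whole CLOSED window of shell `n`
  have hagree : ∀ (n : ℤ) (t : ℝ), t / s ^ n ∈ Icc (-s) (-1) → a t = Z n (t / s ^ n) / g ^ n := by
    intro n t ht
    have h1 : s ^ n ≤ -t := (hu_le n t).1 ht.2
    have h2 : -t ≤ s ^ (n + 1) := (hu_ge n t).1 ht.1
    have ht0 : t < 0 := by linarith [hsn n]
    rcases h2.lt_or_eq with hlt | heq
    · rw [hadef, huniq t ht0 n ⟨h1, hlt⟩]
    · -- junction `t = -s^{n+1}`: the window of shell `n+1` at `u = -1`; relative periodicity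
      have hN : N t = n + 1 := huniq t ht0 (n + 1) (by
        rw [heq]; exact ⟨le_rfl, zpow_lt_zpow_right₀ hs (by omega)⟩)
      have hu1 : t / s ^ (n + 1) = -1 := by
        rw [div_eq_iff (hsn (n + 1)).ne']; linarith
      have hu2 : t / s ^ n = -s := by
        rw [div_eq_iff (hsn n).ne']; rw [hs_succ] at heq; linarith
      rw [hadef, hN, hu1, hu2, hper (n + 1), add_sub_cancel_right, zpow_add_one₀ hgne]
      field_simp
  -- the scalar-front right-hand side
  -- derivative of `a` on the closed window of shell `n`
  have hpiece : ∀ (n : ℤ) (t : ℝ), t / s ^ n ∈ Icc (-s) (-1) →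
      HasDerivWithinAt a (L / s ^ 2 * a (t / s) ^ 2 - s / L * a t * a (s * t))
        ((fun r => r / s ^ n) ⁻¹' Icc (-s) (-1)) t := by
    intro n t ht
    have hinner : HasDerivAt (fun r : ℝ => r / s ^ n) (1 / s ^ n) t := (hasDerivAt_id t).div_const _
    have hcomp := ((hZ n (t / s ^ n) ht).comp t hinner.hasDerivWithinAt (mapsTo_preimage _ _)).div_const
      (g ^ n)
    have h' : HasDerivWithinAt a
        ((L ^ (n - 1) * Z (n - 1) (t / s ^ n) ^ 2 - L ^ n * Z n (t / s ^ n) * Z (n + 1) (t / s ^ n))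
          * (1 / s ^ n) / g ^ n) ((fun r => r / s ^ n) ⁻¹' Icc (-s) (-1)) t :=
      hcomp.congr (fun r hr => hagree n r hr) (hagree n t ht)
    refine h'.congr_deriv ?_
    -- the three values of `a` entering the right-hand side
    have e1 : t / s / s ^ (n - 1) = t / s ^ n := by
      rw [zpow_sub_one₀ hsne]; field_simp
    have e2 : s * t / s ^ (n + 1) = t / s ^ n := by
      rw [hs_succ]; field_simp
    have ha1 : a (t / s) = Z (n - 1) (t / s ^ n) / g ^ (n - 1) := by
      rw [hagree (n - 1) (t / s) (by rw [e1]; exact ht), e1]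
    have ha2 : a (s * t) = Z (n + 1) (t / s ^ n) / g ^ (n + 1) := by
      rw [hagree (n + 1) (s * t) (by rw [e2]; exact ht), e2]
    rw [ha1, ha2, hagree n t ht, hgdef]
    exact piece_identity hLne hsne n _ _ _
  -- the ODE at every `t < 0`: glue the one-sided derivatives at the junctions
  have hφc : ∀ n : ℤ, Continuous fun r : ℝ => r / s ^ n := fun n => by fun_prop
  have hode : ∀ t : ℝ, t < 0 →
      HasDerivAt a (L / s ^ 2 * a (t / s) ^ 2 - s / L * a t * a (s * t)) t := by
    intro t ht
    obtain ⟨h1, h2⟩ := hN t ht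
    have hmem : t / s ^ N t ∈ Icc (-s) (-1) :=
      ⟨((hu_gt (N t) t).2 h2).le, (hu_le (N t) t).2 h1⟩
    have hleft : HasDerivWithinAt a (L / s ^ 2 * a (t / s) ^ 2 - s / L * a t * a (s * t)) (Iic t) t := by
      refine (hpiece (N t) t hmem).mono_of_mem_nhdsWithin ?_
      have hU : (fun r => r / s ^ N t) ⁻¹' Ioi (-s) ∈ 𝓝 t :=
        (hφc (N t)).continuousAt.preimage_mem_nhds (Ioi_mem_nhds ((hu_gt (N t) t).2 h2))
      filter_upwards [inter_mem_nhdsWithin (Iic t) hU] with r hr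
      exact ⟨le_of_lt hr.2, (div_le_div_of_nonneg_right hr.1 (hsn (N t)).le).trans hmem.2⟩
    have hright : HasDerivWithinAt a (L / s ^ 2 * a (t / s) ^ 2 - s / L * a t * a (s * t)) (Ici t) t := by
      rcases hmem.2.lt_or_eq with hlt | heq
      · refine (hpiece (N t) t hmem).mono_of_mem_nhdsWithin ?_
        have hU : (fun r => r / s ^ N t) ⁻¹' Iio (-1) ∈ 𝓝 t :=
          (hφc (N t)).continuousAt.preimage_mem_nhds (Iio_mem_nhds hlt)
        filter_upwards [inter_mem_nhdsWithin (Ici t) hU] with r hr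
        exact ⟨hmem.1.trans (div_le_div_of_nonneg_right hr.1 (hsn (N t)).le), le_of_lt hr.2⟩
      · -- junction: `t = -s^{N t}` is the left end of the window of shell `N t - 1`
        have heq' : t / s ^ (N t - 1) = -s := by
          rw [div_eq_iff (hsn (N t - 1)).ne']
          have ht' : t = -1 * s ^ N t := (div_eq_iff (hsn (N t)).ne').1 heq
          calc t = -1 * s ^ N t := ht'
            _ = -s * (s ^ N t / s) := by field_simp
            _ = -s * s ^ (N t - 1) := by rw [zpow_sub_one₀ hsne, div_eq_mul_inv]
        have hmem' : t / s ^ (N t - 1) ∈ Icc (-s) (-1) := by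
          rw [heq']; exact ⟨le_rfl, by linarith⟩
        refine (hpiece (N t - 1) t hmem').mono_of_mem_nhdsWithin ?_
        have hU : (fun r => r / s ^ (N t - 1)) ⁻¹' Iio (-1) ∈ 𝓝 t :=
          (hφc (N t - 1)).continuousAt.preimage_mem_nhds (Iio_mem_nhds (by
            show t / s ^ (N t - 1) < -1
            rw [heq']; linarith))
        filter_upwards [inter_mem_nhdsWithin (Ici t) hU] with r hr
        exact ⟨hmem'.1.trans (div_le_div_of_nonneg_right hr.1 (hsn (N t - 1)).le), le_of_lt hr.2⟩
    have := hleft.union hright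
    rwa [Iic_union_Ici, hasDerivWithinAt_univ] at this
  -- envelopes
  have hB0 : 0 ≤ B := by
    have h := hB 0 le_rfl (-1) ⟨by linarith, le_rfl⟩
    rw [zpow_zero, inv_one, mul_one] at h
    exact (abs_nonneg _).trans h
  have hP0 : 0 ≤ P := by
    have h := hP (-1) (by norm_num) (-1) ⟨by linarith, le_rfl⟩
    exact nonneg_of_mul_nonneg_left ((abs_nonneg _).trans h) (hgn (-1))
  have hwake' : ∀ t : ℝ, t < 0 → -t < 1 → |a t| ≤ P := by
    intro t ht ht1
    obtain ⟨h1, h2⟩ := hN t ht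
    have hneg : N t < 0 := by
      by_contra hnn
      have : (1 : ℝ) ≤ s ^ N t := one_le_zpow₀ hs.le (not_lt.1 hnn)
      linarith
    have hmem : t / s ^ N t ∈ Icc (-s) (-1) :=
      ⟨((hu_gt (N t) t).2 h2).le, (hu_le (N t) t).2 h1⟩
    rw [hadef, abs_div, abs_of_pos (hgn (N t)), div_le_iff₀ (hgn (N t))]
    exact hP (N t) hneg _ hmem
  have hlead' : ∀ t : ℝ, t < 0 → 1 ≤ -t → |a t| ≤ B * s ^ 2 / t ^ 2 := by
    intro t ht ht1
    obtain ⟨h1, h2⟩ := hN t ht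
    have hnn : 0 ≤ N t := by
      by_contra hneg
      have : s ^ (N t + 1) ≤ 1 := zpow_le_one_of_nonpos₀ hs.le (by omega)
      linarith
    have hmem : t / s ^ N t ∈ Icc (-s) (-1) :=
      ⟨((hu_gt (N t) t).2 h2).le, (hu_le (N t) t).2 h1⟩
    have hsq : (s * L) ^ N t * g ^ N t = s ^ N t * s ^ N t := by
      rw [hgdef, mul_zpow, div_zpow]
      field_simp
    rw [hadef, abs_div, abs_of_pos (hgn (N t)), div_le_iff₀ (hgn (N t))]
    refine (hB (N t) hnn _ hmem).trans ?_
    have htpos : 0 < -t := neg_pos.2 ht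
    have ht2 : 0 < t ^ 2 := by nlinarith
    have hsl : 0 < (s * L) ^ N t := zpow_pos (mul_pos hs0 hL) _
    have h3 : t ^ 2 ≤ s ^ 2 * (s ^ N t * s ^ N t) := by
      have hlt : -t < s ^ N t * s := by rwa [hs_succ] at h2
      have hA : 0 < s ^ N t * s - -t := by linarith
      have hB' : 0 < s ^ N t * s + -t := by nlinarith [hsn (N t)]
      nlinarith [mul_pos hA hB']
    have key : ((s * L) ^ N t)⁻¹ ≤ s ^ 2 / t ^ 2 * g ^ N t := by
      rw [inv_eq_one_div, div_le_iff₀ hsl]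
      have : s ^ 2 / t ^ 2 * g ^ N t * (s * L) ^ N t = s ^ 2 * ((s * L) ^ N t * g ^ N t) / t ^ 2 := by
        ring
      rw [this, hsq, le_div_iff₀ ht2, one_mul]
      exact h3
    calc B * ((s * L) ^ N t)⁻¹ ≤ B * (s ^ 2 / t ^ 2 * g ^ N t) := mul_le_mul_of_nonneg_left key hB0
      _ = B * s ^ 2 / t ^ 2 * g ^ N t := by ring
  -- one integrable majorant on the whole of `(-∞, 0)`
  set C : ℝ := 2 * max P (B * s ^ 2) with hCdef
  have hC0 : 0 ≤ C := by
    have : 0 ≤ max P (B * s ^ 2) := le_max_of_le_left hP0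
    rw [hCdef]; linarith
  have hmaj : ∀ t : ℝ, t < 0 → |a t| ≤ C * (1 + t ^ 2)⁻¹ := by
    intro t ht
    have hM : 0 ≤ max P (B * s ^ 2) := le_max_of_le_left hP0
    have hpos : 0 < 1 + t ^ 2 := by positivity
    rw [← div_eq_mul_inv, le_div_iff₀ hpos, hCdef]
    by_cases h1 : -t < 1
    · have hsq : t ^ 2 < 1 := by nlinarith
      calc |a t| * (1 + t ^ 2) ≤ P * (1 + t ^ 2) :=
            mul_le_mul_of_nonneg_right (hwake' t ht h1) hpos.le
        _ ≤ max P (B * s ^ 2) * (1 + t ^ 2) := mul_le_mul_of_nonneg_right (le_max_left _ _) hpos.le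
        _ ≤ 2 * max P (B * s ^ 2) := by nlinarith
    · have h1' : 1 ≤ -t := not_lt.1 h1
      have hsq : 1 ≤ t ^ 2 := by nlinarith
      have ht2 : 0 < t ^ 2 := by linarith
      have hb := hlead' t ht h1'
      have hb' : |a t| * t ^ 2 ≤ B * s ^ 2 := by
        rwa [le_div_iff₀ ht2] at hb
      calc |a t| * (1 + t ^ 2) ≤ |a t| * (2 * t ^ 2) := by
            exact mul_le_mul_of_nonneg_left (by linarith) (abs_nonneg _)
        _ = 2 * (|a t| * t ^ 2) := by ring
        _ ≤ 2 * (B * s ^ 2) := by linarith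
        _ ≤ 2 * max P (B * s ^ 2) := by linarith [le_max_right P (B * s ^ 2)]
  -- integrability on `(-∞, 0)`
  have hcont : ContinuousOn a (Iio 0) := fun t ht => (hode t ht).continuousAt.continuousWithinAt
  have hint : IntegrableOn a (Iio 0) := by
    refine Integrable.mono' ((integrable_inv_one_add_sq.const_mul C).integrableOn)
      (hcont.aestronglyMeasurable measurableSet_Iio) ?_
    refine (ae_restrict_iff' measurableSet_Iio).2 (Filter.Eventually.of_forall fun t ht => ?_)
    rw [Real.norm_eq_abs]
    exact hmaj t ht
  refine ⟨a, hode, hint, ⟨-1, by norm_num, C, fun t _ ht => ?_⟩, fun n u hu => ?_⟩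
  · refine (hmaj t ht).trans ?_
    have : (1 + t ^ 2)⁻¹ ≤ 1 := inv_le_one_of_one_le₀ (by nlinarith)
    exact (mul_le_mul_of_nonneg_left this hC0).trans (by rw [mul_one])
  · have h := hagree n (s ^ n * u) (by rwa [mul_div_cancel_left₀ _ (hsn n).ne'])
    rwa [mul_div_cancel_left₀ _ (hsn n).ne'] at h

/-- **One-period lattice witnesses give admissible DSS waves of the dyadic member.**  At scale ratio
`1+ε₀` (`Λ = bigLam ε₀`), a one-period relative periodic orbit `Z` of the inviscid dyadic lattice on
`[-s, -1]` with the two envelopes and a non-zero value yields an admissible single-profile DSS wave of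
`dyadicTable` with delay `log s` which is not identically zero.
[cite: Tao2016AveragedNS, §1.2 (dyadic model), §4 Lemma 4.1 (4.8) in the self-similar variables of
§6.4; cell vocabulary (`IsDSSWave`, `dyadicTable`); tree `isDSSWave_dyadic_of_scalarFront`] -/
theorem isDSSWave_dyadic_of_latticePeriod {ε₀ s : ℝ} (hε : 0 < ε₀) (hs : 1 < s) {Z : ℤ → ℝ → ℝ}
    (hZ : ∀ n : ℤ, ∀ u ∈ Icc (-s) (-1), HasDerivWithinAt (Z n)
      (bigLam ε₀ ^ (n - 1) * Z (n - 1) u ^ 2 - bigLam ε₀ ^ n * Z n u * Z (n + 1) u) (Icc (-s) (-1)) u)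
    (hper : ∀ n : ℤ, Z n (-1) = s / bigLam ε₀ * Z (n - 1) (-s))
    (hwake : ∃ P : ℝ, ∀ n : ℤ, n < 0 → ∀ u ∈ Icc (-s) (-1), |Z n u| ≤ P * (s / bigLam ε₀) ^ n)
    (hlead : ∃ B : ℝ, ∀ n : ℤ, 0 ≤ n → ∀ u ∈ Icc (-s) (-1), |Z n u| ≤ B * ((s * bigLam ε₀) ^ n)⁻¹)
    (hne : ∃ n : ℤ, ∃ u ∈ Icc (-s) (-1), Z n u ≠ 0) :
    ∃ a : ℝ → ℝ,
      IsDSSWave ε₀ dyadicTable (1 : Equiv.Perm (Fin 1)) (Real.log s)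
        (fun _ x => (Real.exp (-x) * a (-Real.exp (-x))) • EuclideanSpace.single 0 (1 : ℝ)) ∧
      ∃ t : ℝ, t < 0 ∧ a t ≠ 0 := by
  have hΛ : 0 < bigLam ε₀ := bigLam_pos (by linarith)
  obtain ⟨a, hode, hint, hbdd, hdict⟩ := scalarFront_of_latticePeriod hΛ hs hZ hper hwake hlead
  obtain ⟨n, u, hu, hZne⟩ := hne
  refine ⟨a, isDSSWave_dyadic_of_scalarFront hε hs hode hint hbdd, s ^ n * u, ?_, ?_⟩
  · exact mul_neg_of_pos_of_neg (zpow_pos (lt_trans zero_lt_one hs) n) (by linarith [hu.2])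
  · rw [hdict n u hu]
    exact div_ne_zero hZne (zpow_pos (div_pos (lt_trans zero_lt_one hs) hΛ) n).ne'

/-- **The construction item reduced: one-period lattice witnesses ⟹ `DyadicScalarFronts`.**  If at
arbitrarily small scale ratios the inviscid dyadic lattice `Ż_n = Λ^{n-1}Z_{n-1}² − Λ^n Z_n Z_{n+1}`
(`Λ = (1+ε₀)^{5/2}`) has, for some `s > 1`, a solution on the FINITE time interval `[-s, -1]` whose end
state is `s/Λ` times the shift of its start state (`Z_n(-1) = (s/Λ) Z_{n-1}(-s)`), inside the wake
envelope `|Z_n| ≤ P (s/Λ)ⁿ` (`n < 0`) and the leading-edge envelope `|Z_n| ≤ B (sΛ)^{-n}` (`n ≥ 0`),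
and not identically zero, then `DyadicScalarFronts` holds.  This is the shape (relative periodic
orbit of a finite-time lattice flow composed with the shift) in which the tree's perpetual circuit pump
was constructed (`PerpetualPumpCircuitPump`); the advanced–retarded profile equation on `(-∞,0)` and
its admissibility clauses are discharged here once and for all.
[cite: Tao2016AveragedNS, §1.2, §4 Lemma 4.1 (4.8); cell vocabulary (`DyadicScalarFronts`, p589335)] -/
theorem dyadicScalarFronts_of_latticePeriods
    (h : ∀ ε : ℝ, 0 < ε → ∃ ε₀ : ℝ, 0 < ε₀ ∧ ε₀ ≤ ε ∧ ∃ s : ℝ, 1 < s ∧ ∃ Z : ℤ → ℝ → ℝ,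
      (∀ n : ℤ, ∀ u ∈ Icc (-s) (-1), HasDerivWithinAt (Z n)
        (bigLam ε₀ ^ (n - 1) * Z (n - 1) u ^ 2 - bigLam ε₀ ^ n * Z n u * Z (n + 1) u)
        (Icc (-s) (-1)) u) ∧
      (∀ n : ℤ, Z n (-1) = s / bigLam ε₀ * Z (n - 1) (-s)) ∧
      (∃ P : ℝ, ∀ n : ℤ, n < 0 → ∀ u ∈ Icc (-s) (-1), |Z n u| ≤ P * (s / bigLam ε₀) ^ n) ∧
      (∃ B : ℝ, ∀ n : ℤ, 0 ≤ n → ∀ u ∈ Icc (-s) (-1), |Z n u| ≤ B * ((s * bigLam ε₀) ^ n)⁻¹) ∧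
      (∃ n : ℤ, ∃ u ∈ Icc (-s) (-1), Z n u ≠ 0)) :
    DyadicScalarFronts := by
  intro ε hε
  obtain ⟨ε₀, hε₀, hle, s, hs, Z, hZ, hper, hwake, hlead, n, u, hu, hZne⟩ := h ε hε
  have hΛ : 0 < bigLam ε₀ := bigLam_pos (by linarith)
  obtain ⟨a, hode, hint, hbdd, hdict⟩ := scalarFront_of_latticePeriod hΛ hs hZ hper hwake hlead
  refine ⟨ε₀, hε₀, hle, s, hs, a, hode, hint, hbdd, s ^ n * u, ?_, ?_⟩
  · exact mul_neg_of_pos_of_neg (zpow_pos (lt_trans zero_lt_one hs) n) (by linarith [hu.2])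
  · rw [hdict n u hu]
    exact div_ne_zero hZne (zpow_pos (div_pos (lt_trans zero_lt_one hs) hΛ) n).ne'

/-- **Kill criterion for `TailRatchet` in lattice form.**  One-period relative periodic orbits of the
inviscid dyadic lattice at arbitrarily small scale ratios (as in
`dyadicScalarFronts_of_latticePeriods`) refute the crux `WakeRatchet.TailRatchet`
(stmt-NavierStokesRegularity-21808), via `TailRatchet_false_of_DyadicScalarFronts`.
[cite: Tao2016AveragedNS, §1.2, §4; cell vocabulary] -/
theorem not_tailRatchet_of_latticePeriods
    (h : ∀ ε : ℝ, 0 < ε → ∃ ε₀ : ℝ, 0 < ε₀ ∧ ε₀ ≤ ε ∧ ∃ s : ℝ, 1 < s ∧ ∃ Z : ℤ → ℝ → ℝ,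
      (∀ n : ℤ, ∀ u ∈ Icc (-s) (-1), HasDerivWithinAt (Z n)
        (bigLam ε₀ ^ (n - 1) * Z (n - 1) u ^ 2 - bigLam ε₀ ^ n * Z n u * Z (n + 1) u)
        (Icc (-s) (-1)) u) ∧
      (∀ n : ℤ, Z n (-1) = s / bigLam ε₀ * Z (n - 1) (-s)) ∧
      (∃ P : ℝ, ∀ n : ℤ, n < 0 → ∀ u ∈ Icc (-s) (-1), |Z n u| ≤ P * (s / bigLam ε₀) ^ n) ∧
      (∃ B : ℝ, ∀ n : ℤ, 0 ≤ n → ∀ u ∈ Icc (-s) (-1), |Z n u| ≤ B * ((s * bigLam ε₀) ^ n)⁻¹) ∧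
      (∃ n : ℤ, ∃ u ∈ Icc (-s) (-1), Z n u ≠ 0)) :
    ¬ Summit.NavierStokesRegularity.NavierStokesRegularity.Theses.WakeRatchet.TailRatchet :=
  TailRatchet_false_of_DyadicScalarFronts (dyadicScalarFronts_of_latticePeriods h)

end WakeRatchetLatticePeriod

end Summit.NavierStokesRegularity.NavierStokesRegularity.Theorems

end
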